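import Literature.NumberTheory.Automorphic.ArchLocalWallAveragedTestFunction   -- ★ (d3a-II) p06 (g10): `contDiff_one_averagedTestFunction`, `contDiff_endoForm_left`, tokens `endoForm`, `archLocal`
import Literature.Analysis.FunctionSpaces.ParametricIntegralSmooth              -- ★ `contDiff_parametric_integral` (iterated differentiation under ∫ against a finite measure on a compact)
import HarnessLib

/-!
# THE AVERAGED 2×2 TEST FUNCTION `f♭(X) = ∫_{G_w} β(g) Θ(↑↑g · endoForm X D · ↑↑g⁻¹) dν(g)` IS `C^∞` FOR `Θ ∈ C^∞` (ROAD A, road (Z) step «Z5-pre»; Hörmander I Thm. 1.1.9, Folland 1995 Thm. 2.27)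

Topic `NumberTheory/Automorphic`; namespaces `Literature.NumberTheory.Automorphic` (§1, generic) and `….UnitaryGroup` (§2).  THEOREMS ONLY (no `def`, no instance, no notation, no axiom, no named
fact, no `sorry`).  Cell `pub/hodgecm-mathlib`, ENGINE T1 (crux H413 = `stmt-HodgeConjecture-24833`); ROAD A (N1 = closer `stub_L21` ∕ SdArch `stub_ArchCentralLimitU21`), road (Z) to the row
(J3-odd)₃ (A-p18 (g25) census 7db511ac + HANDOFF `HANDOFF-Z3-RadialODE` 73ae52d6 §Z5: «NEEDS `f♭ ∈ C³`: ★ (d3a-II) `contDiff_one_averagedTestFunction` is `C¹` only — upgrade»); author F0P3a-p05 (g14)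
(ROAD A owner), 2026-09-01.  Sibling (append-free) of ★ `ArchLocalWallAveragedTestFunction` (F0P3a-p06 (g10)): same tokens, same `f♭`; here the order is `∞` (and every `n`).

THE MATHEMATICS.  `f♭(X) = ∫_{G_w} β(g)·Θ(↑↑g · endoForm X D · ↑↑g⁻¹) dν(g)` with `β ∈ C_c(G_w)` real and `Θ ∈ C^∞(M₃(ℂ))` (ambient).  Since `β` vanishes off the compact `tsupport β`, the integral is against the
FINITE measure `ν|_{tsupport β}`, the integration variable enters only through `ι(g) = (β g, ↑↑g, ↑↑g⁻¹)`, which on `tsupport β` stays in the compact `ι(tsupport β)`, and the integrand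
`G((b,P,Q), X) = b • Θ(P · endoForm X D · Q)` is jointly `C^∞` (`X ↦ endoForm X D` is affine, ★ `contDiff_endoForm_left`).  So the tree's ★ `contDiff_parametric_integral` (iterated differentiation under the
integral sign against a finite measure concentrated on a compact) gives **`f♭ ∈ C^∞`** (§2 `contDiff_averagedTestFunction`), hence `f♭ ∈ Cⁿ` for every `n` (`contDiff_averagedTestFunction_of_le`; `n = 3` is
what Z5 consumes).  §1 is the generic form `X ↦ ∫ β(t) • Ψ(y t, X) dν(t)` (any `E`-valued `Ψ ∈ C^∞`, `β ∈ C_c`, `ν` finite on compacts) and its `ℂ`-valued `*`-spelling matching (d3a-II).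
HONEST LABEL: calculus bookkeeping over ★ files; HC_CM is proved only modulo the printed citations until rung 0 closes and this file pays nothing by itself.

## References
* [HormanderALPDO1] L. Hörmander, *The Analysis of Linear Partial Differential Operators I*, 2nd ed. (1990), Thm. 1.1.9 (differentiation under the integral sign, iterated).
* [Folland1995] G. B. Folland, *A Course in Abstract Harmonic Analysis* (1995), Thm. 2.27, §2.6.
* [Rogawski1990] J. D. Rogawski, *Automorphic Representations of Unitary Groups in Three Variables*, Ann. of Math. Stud. 123 (1990), §8.2 p. 123 (the wall averaging this serves).
-/

set_option autoImplicit false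

noncomputable section

open MeasureTheory Measure NumberField NumberField.InfinitePlace Filter Topology Set
open Literature.NumberTheory.Rogawski1990
open scoped MatrixGroups Matrix.Norms.Operator ContDiff

namespace Literature.NumberTheory.Automorphic

/-! ## §1 Generic: `X ↦ ∫ β(t) • Ψ(y t, X) dν(t)` is `C^∞` for `Ψ ∈ C^∞` and `β ∈ C_c` -/

section Generic

variable {Y : Type*} [TopologicalSpace Y] [MeasurableSpace Y] [BorelSpace Y]
  {P : Type*} [NormedAddCommGroup P] [NormedSpace ℝ P] [SecondCountableTopology P]
  {V : Type*} [NormedAddCommGroup V] [NormedSpace ℝ V] [FiniteDimensional ℝ V]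
  {E : Type*} [NormedAddCommGroup E] [NormedSpace ℝ E]

/-- **ITERATED DIFFERENTIATION UNDER THE INTEGRAL SIGN WITH A COMPACTLY SUPPORTED CONTINUOUS WEIGHT**: for `Ψ : P × V → E` of class `C^∞`, `y : Y → P` continuous and `β ∈ C_c(Y)` real, and
`ν` finite on compact sets, `X ↦ ∫ β(t) • Ψ(y t, X) dν(t)` is `C^∞` on the finite-dimensional `V`.  (Restrict `ν` to `tsupport β` — a finite measure; the data `(β t, y t)` then range in a
compact; apply ★ `contDiff_parametric_integral` to `G((b,p),X) = b • Ψ(p,X)`.) [cite: HormanderALPDO1, Thm. 1.1.9] [cite: Folland1995, Thm. 2.27] -/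
theorem contDiff_integral_smul_comp (ν : Measure Y) [IsFiniteMeasureOnCompacts ν]
    (Ψ : P × V → E) (hΨ : ContDiff ℝ ∞ Ψ) (y : Y → P) (hy : Continuous y) (β : Y → ℝ) (hβ : Continuous β) (hβs : HasCompactSupport β) :
    ContDiff ℝ ∞ fun X : V => ∫ t, β t • Ψ (y t, X) ∂ν := by
  letI : MeasurableSpace P := borel P
  haveI : BorelSpace P := ⟨rfl⟩
  -- restrict to the compact `tsupport β`
  set S : Set Y := tsupport β with hS
  have hSc : IsCompact S := hβs
  have hSm : MeasurableSet S := (isClosed_tsupport β).measurableSet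
  have hrestr : (fun X : V => ∫ t, β t • Ψ (y t, X) ∂ν) = fun X : V => ∫ t, β t • Ψ (y t, X) ∂(ν.restrict S) := by
    funext X
    refine (setIntegral_eq_integral_of_forall_compl_eq_zero fun t ht => ?_).symm
    rw [image_eq_zero_of_notMem_tsupport ht, zero_smul]
  rw [hrestr]
  haveI : IsFiniteMeasure (ν.restrict S) := ⟨by rw [Measure.restrict_apply_univ]; exact hSc.measure_lt_top⟩
  -- the data map `ι(t) = (β t, y t)` and its compact range on `S`
  set ι : Y → ℝ × P := fun t => (β t, y t) with hι
  have hιc : Continuous ι := hβ.prodMk hy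
  have hιK : ∀ᵐ t ∂(ν.restrict S), ι t ∈ ι '' S := by
    filter_upwards [ae_restrict_mem hSm] with t ht
    exact mem_image_of_mem ι ht
  -- the jointly smooth integrand
  have hG : ContDiff ℝ ∞ fun q : (ℝ × P) × V => q.1.1 • Ψ (q.1.2, q.2) :=
    (contDiff_fst.comp contDiff_fst).smul (hΨ.comp ((contDiff_snd.comp contDiff_fst).prodMk contDiff_snd))
  exact Literature.Analysis.FunctionSpaces.contDiff_parametric_integral (μ := ν.restrict S) hιc.measurable (hSc.image hιc) hιK hG

/-- The same for every finite order `n : ℕ∞`. [cite: HormanderALPDO1, Thm. 1.1.9] -/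
theorem contDiff_integral_smul_comp_of_le (ν : Measure Y) [IsFiniteMeasureOnCompacts ν]
    (Ψ : P × V → E) (hΨ : ContDiff ℝ ∞ Ψ) (y : Y → P) (hy : Continuous y) (β : Y → ℝ) (hβ : Continuous β) (hβs : HasCompactSupport β) (n : ℕ∞) :
    ContDiff ℝ n fun X : V => ∫ t, β t • Ψ (y t, X) ∂ν :=
  (contDiff_integral_smul_comp ν Ψ hΨ y hy β hβ hβs).of_le (by exact_mod_cast le_top)

/-- **`ℂ`-valued, `*`-spelling** (the shape of ★ (d3a-II) `contDiff_one_integral_ofReal_mul_comp`): `X ↦ ∫ (β t : ℂ) * Ψ(y t, X) dν(t)` is `C^∞` for `Ψ ∈ C^∞`.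
[cite: HormanderALPDO1, Thm. 1.1.9] [cite: Folland1995, Thm. 2.27] -/
theorem contDiff_infty_integral_ofReal_mul_comp (ν : Measure Y) [IsFiniteMeasureOnCompacts ν]
    (Ψ : P × V → ℂ) (hΨ : ContDiff ℝ ∞ Ψ) (y : Y → P) (hy : Continuous y) (β : Y → ℝ) (hβ : Continuous β) (hβs : HasCompactSupport β) :
    ContDiff ℝ ∞ fun X : V => ∫ t, (β t : ℂ) * Ψ (y t, X) ∂ν := by
  have h := contDiff_integral_smul_comp ν Ψ hΨ y hy β hβ hβs
  have heq : (fun X : V => ∫ t, (β t : ℂ) * Ψ (y t, X) ∂ν) = fun X : V => ∫ t, β t • Ψ (y t, X) ∂ν := by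
    funext X
    refine integral_congr_ae (Eventually.of_forall fun t => ?_)
    simp only [Complex.real_smul]
  rw [heq]
  exact h

end Generic

/-! ## §2 The averaged test function of the wall averaging on `G_w` is `C^∞` -/

namespace UnitaryGroup

section Wall

variable (L : Type) [Field L] (α : Fin 3 → L) (w : {w : InfinitePlace L // IsComplex w})
variable [MeasurableSpace (archLocal L 3 (Matrix.diagonal α) w)] [BorelSpace (archLocal L 3 (Matrix.diagonal α) w)]

/-- **`f♭ ∈ C^∞`**: for `Θ : Matrix (Fin 3) (Fin 3) ℂ → ℂ` of class `C^∞` (operator norms), `β ∈ C_c(G_w)` real and any `D`, the averaged test function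
`X ↦ ∫_{G_w} β(g) Θ(↑↑g · endoForm X D · ↑↑g⁻¹) dν(g)` is `C^∞` on `Matrix (Fin 2) (Fin 2) ℂ` (§1 with `Ψ((P,Q),X) = Θ(P · endoForm X D · Q)`, jointly `C^∞` by ★ `contDiff_endoForm_left`, and
`y(g) = (↑↑g, ↑↑g⁻¹)`; `ν` any measure finite on compact sets, e.g. Haar). [cite: HormanderALPDO1, Thm. 1.1.9] [cite: Folland1995, Thm. 2.27] [cite: Rogawski1990, §8.2 p. 123] -/
theorem contDiff_averagedTestFunction (ν : Measure (archLocal L 3 (Matrix.diagonal α) w)) [IsFiniteMeasureOnCompacts ν]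
    (β : archLocal L 3 (Matrix.diagonal α) w → ℝ) (hβ : Continuous β) (hβs : HasCompactSupport β)
    (Θ : Matrix (Fin 3) (Fin 3) ℂ → ℂ) (hΘ : ContDiff ℝ ∞ Θ) (D : Matrix (Fin 1) (Fin 1) ℂ) :
    ContDiff ℝ ∞ fun X : Matrix (Fin 2) (Fin 2) ℂ => ∫ g, (β g : ℂ) *
      Θ (((g : GL (Fin 3) ℂ) : Matrix (Fin 3) (Fin 3) ℂ) * endoForm X D * (((g : GL (Fin 3) ℂ)⁻¹ : GL (Fin 3) ℂ) : Matrix (Fin 3) (Fin 3) ℂ)) ∂ν := by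
  have hΨ : ContDiff ℝ ∞ fun q : (Matrix (Fin 3) (Fin 3) ℂ × Matrix (Fin 3) (Fin 3) ℂ) × Matrix (Fin 2) (Fin 2) ℂ => Θ (q.1.1 * endoForm q.2 D * q.1.2) :=
    hΘ.comp (((contDiff_fst.comp contDiff_fst).mul ((contDiff_endoForm_left D).comp contDiff_snd)).mul (contDiff_snd.comp contDiff_fst))
  have hy : Continuous fun g : archLocal L 3 (Matrix.diagonal α) w =>
      ((((g : GL (Fin 3) ℂ) : Matrix (Fin 3) (Fin 3) ℂ)), (((g : GL (Fin 3) ℂ)⁻¹ : GL (Fin 3) ℂ) : Matrix (Fin 3) (Fin 3) ℂ)) :=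
    (Units.continuous_val.comp continuous_subtype_val).prodMk (Units.continuous_coe_inv.comp continuous_subtype_val)
  exact contDiff_infty_integral_ofReal_mul_comp ν _ hΨ _ hy β hβ hβs

/-- **`f♭ ∈ Cⁿ` for every `n : ℕ∞`** (in particular `n = 3`, which Z5 consumes, and `n = 1` = ★ (d3a-II) for smooth `Θ`). [cite: HormanderALPDO1, Thm. 1.1.9] [cite: Folland1995, Thm. 2.27] -/
theorem contDiff_averagedTestFunction_of_le (ν : Measure (archLocal L 3 (Matrix.diagonal α) w)) [IsFiniteMeasureOnCompacts ν]
    (β : archLocal L 3 (Matrix.diagonal α) w → ℝ) (hβ : Continuous β) (hβs : HasCompactSupport β)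
    (Θ : Matrix (Fin 3) (Fin 3) ℂ → ℂ) (hΘ : ContDiff ℝ ∞ Θ) (D : Matrix (Fin 1) (Fin 1) ℂ) (n : ℕ∞) :
    ContDiff ℝ n fun X : Matrix (Fin 2) (Fin 2) ℂ => ∫ g, (β g : ℂ) *
      Θ (((g : GL (Fin 3) ℂ) : Matrix (Fin 3) (Fin 3) ℂ) * endoForm X D * (((g : GL (Fin 3) ℂ)⁻¹ : GL (Fin 3) ℂ) : Matrix (Fin 3) (Fin 3) ℂ)) ∂ν :=
  (contDiff_averagedTestFunction L α w ν β hβ hβs Θ hΘ D).of_le (by exact_mod_cast le_top)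

/-- **`f♭ ∈ C³`** — the order road (Z) step Z5 takes BY NAME. [cite: HormanderALPDO1, Thm. 1.1.9] [cite: Rogawski1990, §8.2 p. 123] -/
theorem contDiff_three_averagedTestFunction (ν : Measure (archLocal L 3 (Matrix.diagonal α) w)) [IsFiniteMeasureOnCompacts ν]
    (β : archLocal L 3 (Matrix.diagonal α) w → ℝ) (hβ : Continuous β) (hβs : HasCompactSupport β)
    (Θ : Matrix (Fin 3) (Fin 3) ℂ → ℂ) (hΘ : ContDiff ℝ ∞ Θ) (D : Matrix (Fin 1) (Fin 1) ℂ) :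
    ContDiff ℝ 3 fun X : Matrix (Fin 2) (Fin 2) ℂ => ∫ g, (β g : ℂ) *
      Θ (((g : GL (Fin 3) ℂ) : Matrix (Fin 3) (Fin 3) ℂ) * endoForm X D * (((g : GL (Fin 3) ℂ)⁻¹ : GL (Fin 3) ℂ) : Matrix (Fin 3) (Fin 3) ℂ)) ∂ν :=
  contDiff_averagedTestFunction_of_le L α w ν β hβ hβs Θ hΘ D 3

end Wall

end UnitaryGroup

end Literature.NumberTheory.Automorphic

end
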